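import Summits.CriticalPhenomena.CardyFormulaZ2.Theses.CardyComplexCone
import Summits.CriticalPhenomena.CardyFormulaZ2.Theorems.CardyComplexConeParafermionToSLESixFamiliesDefs
import Literature.Probability.Percolation.InterfaceScalingLimitDiscretised
import Literature.Probability.LatticeModels.MedialInterfaceMeasurability
import Literature.Probability.RandomPlanarGeometry.SLEConvergenceCriterion
import Literature.Probability.Percolation.InterfaceTraversalBound
import Literature.Probability.Percolation.InterfaceTraversalBoundData4
import HarnessLib

/-!
# Stub `stub_tightFamilies` of line `caratheodory-net-slit-uniformity` (crux `ParafermionToSLESixFamilies`, stmt-CriticalPhenomena-11389)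

Tightness of the interface laws of every discretisation FAMILY of a Dobrushin domain
(`TightFamilies`, the Prokhorov half of the line's assembly
`convergesInLawToSLE_of_isTightAlongMesh`): Aizenman–Burchard, Duke Math. J. 99 (1999), Thm 1.2
(uniform power bounds on multiple annulus traversals from RSW + BK ⇒ tightness), for the
bond-percolation medial exploration interface of ARBITRARY admissible data `Λ δ` with
`(Λ δ).Ω = D.carrier`, `(Λ δ).δ = δ`. The tree proved the canonical-data case
(`isTightLaws_map_bondInterface_holds`, `InterfaceTraversalBound.lean`); the Literature files
`InterfaceTraversalBoundData{,2,3,4}.lean` carry the same proof out for arbitrary data (the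
canonical proof never uses the arcs of the data beyond the generic `DiscreteDobrushin`
interface), ending in `ZdDiscretisationFamily.isTightAlongMesh_bondInterfaceIn`, of which the
stub is the verbatim specialisation.
-/

noncomputable section

open scoped Topology NNReal ENNReal
open Filter Set MeasureTheory
open Literature.Probability Literature.Probability.LatticeModels Literature.Probability.Percolation
open Literature.Probability.RandomPlanarGeometry

namespace Summit.CriticalPhenomena.CardyFormulaZ2.Cruxes.ParafermionToSLESixFamilies.CaratheodoryNetSlitUniformity

/-- **Stub `stub_tightFamilies`: tightness of the interface laws of discretisation families**
(Aizenman–Burchard 1999, Thm 1.2 and App. A, from RSW/BK on `ℤ²`, for arbitrary admissible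
discrete Dobrushin data with carrier `D`): the registered statement `TightFamilies`, by
`ZdDiscretisationFamily.isTightAlongMesh_bondInterfaceIn` (`InterfaceTraversalBoundData4.lean`). -/
theorem stub_tightFamilies : TightFamilies :=
  fun _D _Λ hΛ => hΛ.isTightAlongMesh_bondInterfaceIn

end Summit.CriticalPhenomena.CardyFormulaZ2.Cruxes.ParafermionToSLESixFamilies.CaratheodoryNetSlitUniformity

end
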